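import Literature.Analysis.SpecialFunctions.EllipticKQuarticReduction
import Literature.MathematicalPhysics.QuantumLattice.AnisotropicBandDOSFinite
import HarnessLib

/-!
# The density of states of the anisotropic square-lattice band in closed form
# (complete elliptic integral of the first kind)

Topic `Literature/MathematicalPhysics/QuantumLattice`, sequel of
`AnisotropicBandFermiCurveMeasure.lean` (t2: `fermiCurveMeasure_anisoBand_univ`, the density-of-states
mass of the band `ε(k) = -2(a cos k₀ + b cos k₁)` at level `μ` as the one-dimensional integral
`∫_{[-π,π)} 2/√(4b² - (μ + 2a cos x)²) dx`) and of
`Literature/Analysis/SpecialFunctions/EllipticKQuarticReduction.lean` (Gradshteyn–Ryzhik 3.147.4).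
For `a, b > 0` the substitution `c = cos x` turns that integral into
`(2/a) ∫ dc/√((1-c)(1+c)(c₁-c)(c-c₂))` over the middle gap of the four roots
`{1, -1, c₁ = (2b-μ)/(2a), c₂ = -(2b+μ)/(2a)}`, and GR 3.147.4 evaluates it. Writing
`W = 2(a+b)` (band edge), `V = 2|a-b|` (van Hove energy), `P = W² - μ²`, `D = 16ab`, all PROVED:

* `lintegral_anisoDOS_inner` — `|μ| < V`:  `∫_{[-π,π)} 2/√(4b²-(μ+2a cos x)²) dx = 8 K(D/P)/√P`;
* `lintegral_anisoDOS_outer` — `V < |μ| < W`:  `… = 2 K(P/D)/√(ab)`;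
* `lintegral_anisoDOS_out` — `|μ| > W`:  `… = 0`;
* `fermiCurveMeasure_anisoBand_univ_inner/outer/out` — the same three statements for
  `fermiCurveMeasure (k ↦ -2(a cos k₀ + b cos k₁)) μ univ` (through t2's theorem);

here `K = Literature.Probability.RandomPlanarGeometry.ellipticK` (parameter convention
`K(m) = ∫₀¹ dt/√((1-t²)(1-m t²))`). Dividing by `(2π)²` gives the density of states per site
`ρ(μ; a, b) = 2K(D/P)/(π²√P)` resp. `K(P/D)/(2π²√(ab))` — formula (1.1) of the cell note CERT-SREP
(gate-hubbard-kl), i.e. the closed form behind the `s`-representation of the square-lattice Lindhard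
function (`lindhardFunction_squareDispersion_eq_sRepresentation`); these are the objects a kernel-level
Kohn–Luttinger certificate would evaluate by the AGM (`ellipticK_eq_pi_div_agm`). At the van Hove
levels `|μ| = V` both sides are `∞` and nothing is claimed.

Auxiliary (proved, reusable): `lintegral_comp_cos_Ioo_eq` (the substitution `c = cos x` on `(0,π)`
for `ℝ≥0∞`-valued integrands) and `lintegral_comp_cos_Ico_eq_two_mul`.

## References
* [RaghuKivelsonScalapino2010] S. Raghu, S. A. Kivelson, D. J. Scalapino, Phys. Rev. B 81 (2010)
  224505, §II (6) (the Lindhard function of the square lattice; anisotropic hopping).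
* [GradshteynRyzhik2015] I. S. Gradshteyn, I. M. Ryzhik, *Table of Integrals, Series, and Products*,
  8th ed., 3.147.4.
* Classical: the square-lattice density of states `ρ(E) = K(1 - E²/16)/(2π²)` (the case `a = b = 1`,
  outer regime with `V = 0`), e.g. E. N. Economou, *Green's Functions in Quantum Physics*, §5.3.2.
-/

noncomputable section

open Real _root_.MeasureTheory _root_.Set
open Literature.Probability.RandomPlanarGeometry

namespace Literature.MathematicalPhysics.QuantumLattice

open Literature.Analysis.SpecialFunctions Literature.Analysis.SpecialFunctions.QuarticReduction
open scoped ENNReal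

/-- **The substitution `c = cos x` on `(0, π)`** for `ℝ≥0∞`-valued integrands:
`∫⁻_{x ∈ (0,π)} F(cos x) dx = ∫⁻_{c ∈ (-1,1)} F(c)/√(1-c²) dc` (the step `u = cos x` of the density-of-states
computation). [cite: RaghuKivelsonScalapino2010, §II (6)] -/
theorem lintegral_comp_cos_Ioo_eq (F : ℝ → ℝ≥0∞) :
    ∫⁻ x in Ioo (0 : ℝ) π, F (Real.cos x) =
      ∫⁻ c in Ioo (-1 : ℝ) 1, ENNReal.ofReal (1 / Real.sqrt (1 - c ^ 2)) * F c := by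
  have hderiv : ∀ c ∈ Ioo (-1 : ℝ) 1,
      HasDerivWithinAt Real.arccos (-(1 / Real.sqrt (1 - c ^ 2))) (Ioo (-1 : ℝ) 1) c := fun c hc =>
    (Real.hasDerivAt_arccos (by linarith [hc.1]) (by linarith [hc.2])).hasDerivWithinAt
  have hinj : InjOn Real.arccos (Ioo (-1 : ℝ) 1) := Real.arccos_injOn.mono Ioo_subset_Icc_self
  have himg : Real.arccos '' Ioo (-1 : ℝ) 1 = Ioo 0 π := by
    apply Subset.antisymm
    · rintro x ⟨c, hc, rfl⟩
      exact ⟨Real.arccos_pos.2 hc.2, Real.arccos_lt_pi.2 hc.1⟩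
    · intro x hx
      have h0 : Real.cos π < Real.cos x :=
        Real.cos_lt_cos_of_nonneg_of_le_pi hx.1.le le_rfl hx.2
      have h1 : Real.cos x < Real.cos 0 :=
        Real.cos_lt_cos_of_nonneg_of_le_pi le_rfl hx.2.le hx.1
      rw [Real.cos_pi] at h0; rw [Real.cos_zero] at h1
      exact ⟨Real.cos x, ⟨h0, h1⟩, Real.arccos_cos hx.1.le hx.2.le⟩
  have h := lintegral_image_eq_lintegral_abs_deriv_mul measurableSet_Ioo hderiv hinj
    (fun x => F (Real.cos x))
  rw [himg] at h
  rw [h]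
  refine setLIntegral_congr_fun measurableSet_Ioo fun c hc => ?_
  rw [Real.cos_arccos hc.1.le hc.2.le, abs_neg, abs_of_nonneg (by positivity)]

/-- From `[-π, π)` to `(0, π)` for even integrands: `∫⁻_{[-π,π)} F(cos x) = 2 ∫⁻_{(0,π)} F(cos x)`
(companion of `lintegral_comp_cos_Ioo_neg_pi`). [cite: RaghuKivelsonScalapino2010, §II (6)] -/
theorem lintegral_comp_cos_Ico_eq_two_mul (F : ℝ → ℝ≥0∞) :
    ∫⁻ x in Ico (-π) π, F (Real.cos x) = 2 * ∫⁻ x in Ioo (0 : ℝ) π, F (Real.cos x) := by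
  have hπ := Real.pi_pos
  have hsplit : Ico (-π) π = Ico (-π) 0 ∪ Ico 0 π := (Ico_union_Ico_eq_Ico (by linarith) hπ.le).symm
  rw [hsplit, lintegral_union measurableSet_Ico (Ico_disjoint_Ico_same)]
  rw [setLIntegral_congr (Ioo_ae_eq_Ico (μ := volume) (a := -π) (b := 0)).symm,
    setLIntegral_congr (Ioo_ae_eq_Ico (μ := volume) (a := (0:ℝ)) (b := π)).symm,
    Literature.MathematicalPhysics.QuantumLattice.lintegral_comp_cos_Ioo_neg_pi, two_mul]

/-- The polynomial identity `4b² - (μ + 2ac)² = 4a²(c₁ - c)(c - c₂)` with the two roots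
`c₁ = (2b-μ)/(2a)`, `c₂ = -(2b+μ)/(2a)`. [folklore] -/
private theorem band_radicand_eq {a : ℝ} (ha : a ≠ 0) (b μ c : ℝ) :
    4 * b ^ 2 - (μ + 2 * a * c) ^ 2 =
      4 * a ^ 2 * (((2 * b - μ) / (2 * a) - c) * (c - (-(2 * b + μ) / (2 * a)))) := by
  field_simp; ring

/-- The integrand after `c = cos x`: for `a > 0` and `c ∈ (-1,1)`,
`(1/√(1-c²)) · 2/√(4b²-(μ+2ac)²) = (1/a)/√((1-c²)(c₁-c)(c-c₂))` (both sides vanish where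
`(c₁-c)(c-c₂) ≤ 0`). [folklore] -/
private theorem integrand_cos_eq {a : ℝ} (ha : 0 < a) (b μ : ℝ) {c : ℝ} (hc : c ∈ Ioo (-1 : ℝ) 1) :
    ENNReal.ofReal (1 / Real.sqrt (1 - c ^ 2)) *
        ENNReal.ofReal (2 / Real.sqrt (4 * b ^ 2 - (μ + 2 * a * c) ^ 2)) =
      ENNReal.ofReal ((1 / a) / Real.sqrt ((1 - c ^ 2) *
        (((2 * b - μ) / (2 * a) - c) * (c - (-(2 * b + μ) / (2 * a)))))) := by
  have h1c : 0 < 1 - c ^ 2 := by nlinarith [hc.1, hc.2]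
  rw [← ENNReal.ofReal_mul (by positivity), band_radicand_eq ha.ne']
  congr 1
  rw [Real.sqrt_mul h1c.le, Real.sqrt_mul (by positivity : (0:ℝ) ≤ 4 * a ^ 2),
    show Real.sqrt (4 * a ^ 2) = 2 * a by
      rw [show (4 : ℝ) * a ^ 2 = (2 * a) ^ 2 by ring, Real.sqrt_sq (by positivity)]]
  have hs : Real.sqrt (1 - c ^ 2) ≠ 0 := (Real.sqrt_pos.2 h1c).ne'
  field_simp

/-- Off the middle gap the quartic is nonpositive, so the integrand vanishes; restrict the
`c`-integral to the gap. [folklore] -/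
private theorem setLIntegral_eq_of_vanish {f : ℝ → ℝ} {s t : Set ℝ} (hs : MeasurableSet s)
    (ht : MeasurableSet t) (hst : s ⊆ t) (hvan : ∀ c ∈ t, c ∉ s → f c ≤ 0) :
    ∫⁻ c in t, ENNReal.ofReal (f c) = ∫⁻ c in s, ENNReal.ofReal (f c) := by
  have h1 : ∫⁻ c in t, ENNReal.ofReal (f c) = ∫⁻ c in t, s.indicator (fun c => ENNReal.ofReal (f c)) c := by
    refine setLIntegral_congr_fun ht fun c hc => ?_
    by_cases hcs : c ∈ s
    · rw [indicator_of_mem hcs]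
    · rw [indicator_of_notMem hcs, ENNReal.ofReal_eq_zero.2 (hvan c hc hcs)]
  rw [h1, lintegral_indicator hs, Measure.restrict_restrict hs, inter_eq_left.2 hst]

variable {a b μ : ℝ}

/-- **Core of the closed form**: if the four roots `{1, -1, c₁, c₂}` (`c₁ = (2b-μ)/(2a)`,
`c₂ = -(2b+μ)/(2a)`) are listed as `a₁ > a₂ > a₃ > a₄` with the middle gap `(a₃,a₂) ⊆ (-1,1)` and
`(1-c²)(c₁-c)(c-c₂) = (a₁-c)(a₂-c)(c-a₃)(c-a₄)`, then
`∫⁻_{[-π,π)} 2/√(4b²-(μ+2a cos x)²) dx = (4/a) K(q²)/√((a₁-a₃)(a₂-a₄))`.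
[cite: GradshteynRyzhik2015, 3.147.4] -/
theorem lintegral_anisoDOS_eq_of_roots (ha : 0 < a) {a₁ a₂ a₃ a₄ : ℝ} (h₁₂ : a₂ < a₁) (h₂₃ : a₃ < a₂)
    (h₃₄ : a₄ < a₃) (hsub : Ioo a₃ a₂ ⊆ Ioo (-1 : ℝ) 1)
    (hq : ∀ c : ℝ, (1 - c ^ 2) * (((2 * b - μ) / (2 * a) - c) * (c - (-(2 * b + μ) / (2 * a)))) =
      (a₁ - c) * (a₂ - c) * (c - a₃) * (c - a₄))
    (hvan : ∀ c ∈ Ioo (-1 : ℝ) 1, c ∉ Ioo a₃ a₂ → (a₁ - c) * (a₂ - c) * (c - a₃) * (c - a₄) ≤ 0) :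
    ∫⁻ x in Ico (-π) π, ENNReal.ofReal (2 / Real.sqrt (4 * b ^ 2 - (μ + 2 * a * Real.cos x) ^ 2)) =
      ENNReal.ofReal (4 / a * ellipticK (modulusSq a₁ a₂ a₃ a₄) / Real.sqrt ((a₁ - a₃) * (a₂ - a₄))) := by
  have hC : 0 < (a₁ - a₃) * (a₂ - a₄) := _root_.mul_pos (by linarith) (by linarith)
  rw [lintegral_comp_cos_Ico_eq_two_mul (fun c => ENNReal.ofReal (2 / Real.sqrt (4 * b ^ 2 - (μ + 2 * a * c) ^ 2))),
    lintegral_comp_cos_Ioo_eq (fun c => ENNReal.ofReal (2 / Real.sqrt (4 * b ^ 2 - (μ + 2 * a * c) ^ 2)))]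
  rw [setLIntegral_congr_fun measurableSet_Ioo fun c hc => integrand_cos_eq ha b μ hc]
  simp_rw [hq]
  have hvan' : ∀ c ∈ Ioo (-1 : ℝ) 1, c ∉ Ioo a₃ a₂ →
      (1 / a) / Real.sqrt ((a₁ - c) * (a₂ - c) * (c - a₃) * (c - a₄)) ≤ 0 := by
    intro c hc hcs
    rw [Real.sqrt_eq_zero'.2 (hvan c hc hcs), div_zero]
  rw [setLIntegral_eq_of_vanish measurableSet_Ioo measurableSet_Ioo hsub hvan']
  have hsplit : ∀ c : ℝ, ENNReal.ofReal ((1 / a) / Real.sqrt ((a₁ - c) * (a₂ - c) * (c - a₃) * (c - a₄))) =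
      ENNReal.ofReal (1 / a) * ENNReal.ofReal (1 / Real.sqrt ((a₁ - c) * (a₂ - c) * (c - a₃) * (c - a₄))) := by
    intro c; rw [← ENNReal.ofReal_mul (by positivity)]; congr 1; ring
  simp_rw [hsplit]
  rw [lintegral_const_mul' _ _ ENNReal.ofReal_ne_top, lintegral_inv_sqrt_quartic_eq_ellipticK h₁₂ h₂₃ h₃₄,
    ← ENNReal.ofReal_mul (by positivity)]
  rw [show (2 : ℝ≥0∞) = ENNReal.ofReal 2 by simp, ← ENNReal.ofReal_mul (by norm_num)]
  congr 1
  field_simp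
  ring

/-- **Inner regime (`|μ| < 2|a-b|`) of the anisotropic square-lattice density of states**
(CERT-SREP (1.1), second line): for `a, b > 0` and `|μ| < 2|a - b|`,
`∫⁻_{[-π,π)} 2/√(4b²-(μ+2a cos x)²) dx = 8 K(16ab/P)/√P`, `P = 4(a+b)² - μ²`
(`K = ellipticK`, parameter convention; this is `(2π)² ρ(μ; a, b)` with `ρ = 2K(1/m)/(π²√P)`, `m = P/(16ab)`).
[cite: GradshteynRyzhik2015, 3.147.4] -/
theorem lintegral_anisoDOS_inner (ha : 0 < a) (hb : 0 < b) (hμ : |μ| < 2 * |a - b|) :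
    ∫⁻ x in Ico (-π) π, ENNReal.ofReal (2 / Real.sqrt (4 * b ^ 2 - (μ + 2 * a * Real.cos x) ^ 2)) =
      ENNReal.ofReal (8 * ellipticK (16 * a * b / (4 * (a + b) ^ 2 - μ ^ 2)) /
        Real.sqrt (4 * (a + b) ^ 2 - μ ^ 2)) := by
  set c₁ : ℝ := (2 * b - μ) / (2 * a) with hc₁
  set c₂ : ℝ := -(2 * b + μ) / (2 * a) with hc₂
  have ha2 : 0 < 2 * a := by linarith
  have hμ' := abs_lt.1 hμ
  have hab : |a - b| ≤ a + b := by rw [abs_le]; constructor <;> linarith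
  have hP : 0 < 4 * (a + b) ^ 2 - μ ^ 2 := by
    have h1 := abs_lt.1 (show |μ| < 2 * (a + b) by linarith)
    nlinarith [h1.1, h1.2]
  have hprod : (c₁ + 1) * (1 - c₂) = (4 * (a + b) ^ 2 - μ ^ 2) / (2 * a) ^ 2 := by
    rw [hc₁, hc₂]; field_simp; ring
  have hdiff : 2 * (c₁ - c₂) = 4 * b / a := by
    rw [hc₁, hc₂]; field_simp; ring
  have hval : ∀ {K : ℝ}, 4 / a * K / Real.sqrt ((4 * (a + b) ^ 2 - μ ^ 2) / (2 * a) ^ 2) =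
      8 * K / Real.sqrt (4 * (a + b) ^ 2 - μ ^ 2) := by
    intro K
    rw [Real.sqrt_div' _ (by positivity), Real.sqrt_sq ha2.le]
    have := (Real.sqrt_pos.2 hP).ne'
    field_simp
    ring
  have hmod : 2 * (c₁ - c₂) / ((c₁ + 1) * (1 - c₂)) = 16 * a * b / (4 * (a + b) ^ 2 - μ ^ 2) := by
    rw [hprod, hdiff]; field_simp; norm_num
  rcases lt_or_ge a b with hab' | hab'
  · -- `b`-dominant: roots `c₁ > 1 > -1 > c₂`, middle gap `(-1, 1)`
    rw [abs_of_neg (by linarith : a - b < 0)] at hμ'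
    have h1 : (1:ℝ) < c₁ := by rw [hc₁, lt_div_iff₀ ha2]; linarith
    have h2 : c₂ < -1 := by rw [hc₂, div_lt_iff₀ ha2]; linarith
    have h := lintegral_anisoDOS_eq_of_roots (b := b) (μ := μ) ha (a₁ := c₁) (a₂ := 1) (a₃ := -1) (a₄ := c₂)
      h1 (by norm_num) h2 Subset.rfl (fun c => by rw [← hc₁, ← hc₂]; ring) (fun c hc hcs => (hcs hc).elim)
    rw [h]
    congr 1
    unfold modulusSq
    rw [show (1 - (-1:ℝ)) * (c₁ - c₂) / ((c₁ - -1) * (1 - c₂)) = 2 * (c₁ - c₂) / ((c₁ + 1) * (1 - c₂)) by ring,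
      hmod, show (c₁ - -1) * (1 - c₂) = (c₁ + 1) * (1 - c₂) by ring, hprod, hval]
  · -- `a`-dominant: roots `1 > c₁ > c₂ > -1`, middle gap `(c₂, c₁)`
    rw [abs_of_nonneg (by linarith : (0:ℝ) ≤ a - b)] at hμ'
    have h1 : c₁ < 1 := by rw [hc₁, div_lt_iff₀ ha2]; linarith
    have h2 : -1 < c₂ := by rw [hc₂, lt_div_iff₀ ha2]; linarith
    have h12 : c₂ < c₁ := by rw [hc₁, hc₂, div_lt_div_iff_of_pos_right ha2]; linarith
    have h := lintegral_anisoDOS_eq_of_roots (b := b) (μ := μ) ha (a₁ := 1) (a₂ := c₁) (a₃ := c₂) (a₄ := -1)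
      h1 h12 h2 (Ioo_subset_Ioo h2.le h1.le) (fun c => by rw [← hc₁, ← hc₂]; ring)
      (fun c hc hcs => by
        rw [mem_Ioo, not_and_or, not_lt, not_lt] at hcs
        have hA : 0 < 1 - c := by linarith [hc.2]
        have hB : 0 < c - -1 := by linarith [hc.1]
        have hq : (c₁ - c) * (c - c₂) ≤ 0 := by
          rcases hcs with hle | hge
          · exact mul_nonpos_of_nonneg_of_nonpos (by linarith) (by linarith)
          · exact mul_nonpos_of_nonpos_of_nonneg (by linarith) (by linarith)
        have : (1 - c) * (c₁ - c) * (c - c₂) * (c - -1) = ((1 - c) * (c - -1)) * ((c₁ - c) * (c - c₂)) := by ring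
        rw [this]
        exact mul_nonpos_of_nonneg_of_nonpos (mul_pos hA hB).le hq)
    rw [h]
    congr 1
    unfold modulusSq
    rw [show (c₁ - c₂) * (1 - (-1:ℝ)) / ((1 - c₂) * (c₁ - -1)) = 2 * (c₁ - c₂) / ((c₁ + 1) * (1 - c₂)) by ring,
      hmod, show (1 - c₂) * (c₁ - -1) = (c₁ + 1) * (1 - c₂) by ring, hprod, hval]

/-- **Outer regime (`2|a-b| < |μ| < 2(a+b)`) of the anisotropic square-lattice density of states**
(CERT-SREP (1.1), first line): for `a, b > 0`,
`∫⁻_{[-π,π)} 2/√(4b²-(μ+2a cos x)²) dx = 2 K(P/(16ab))/√(ab)`, `P = 4(a+b)² - μ²`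
(this is `(2π)² ρ(μ; a, b)` with `ρ = K(m)/(2π²√(ab))`, `m = P/(16ab) ∈ (0,1)`).
[cite: GradshteynRyzhik2015, 3.147.4] -/
theorem lintegral_anisoDOS_outer (ha : 0 < a) (hb : 0 < b) (hμ₁ : 2 * |a - b| < |μ|)
    (hμ₂ : |μ| < 2 * (a + b)) :
    ∫⁻ x in Ico (-π) π, ENNReal.ofReal (2 / Real.sqrt (4 * b ^ 2 - (μ + 2 * a * Real.cos x) ^ 2)) =
      ENNReal.ofReal (2 * ellipticK ((4 * (a + b) ^ 2 - μ ^ 2) / (16 * a * b)) / Real.sqrt (a * b)) := by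
  set c₁ : ℝ := (2 * b - μ) / (2 * a) with hc₁
  set c₂ : ℝ := -(2 * b + μ) / (2 * a) with hc₂
  have ha2 : 0 < 2 * a := by linarith
  have hμ2 := abs_lt.1 hμ₂
  have hprod : (c₁ + 1) * (1 - c₂) = (4 * (a + b) ^ 2 - μ ^ 2) / (2 * a) ^ 2 := by
    rw [hc₁, hc₂]; field_simp; ring
  have hdiff : 2 * (c₁ - c₂) = 4 * b / a := by
    rw [hc₁, hc₂]; field_simp; ring
  have hsq : Real.sqrt (4 * b / a) = 2 * Real.sqrt (a * b) / a := by
    rw [show 4 * b / a = (4 * (a * b)) / a ^ 2 by field_simp,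
      Real.sqrt_div' _ (by positivity), Real.sqrt_sq ha.le, Real.sqrt_mul (by norm_num),
      show Real.sqrt 4 = 2 by rw [show (4:ℝ) = 2 ^ 2 by norm_num, Real.sqrt_sq (by norm_num)]]
  have hval : ∀ {K : ℝ}, 4 / a * K / Real.sqrt (4 * b / a) = 2 * K / Real.sqrt (a * b) := by
    intro K
    rw [hsq]
    have := (Real.sqrt_pos.2 (_root_.mul_pos ha hb)).ne'
    field_simp
    ring
  have hmod : (c₁ + 1) * (1 - c₂) / (2 * (c₁ - c₂)) = (4 * (a + b) ^ 2 - μ ^ 2) / (16 * a * b) := by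
    rw [hprod, hdiff]; field_simp; ring
  rcases lt_or_ge 0 μ with hμ0 | hμ0
  · -- `μ > 0`: roots `1 > c₁ > -1 > c₂`, middle gap `(-1, c₁)`
    rw [abs_of_pos hμ0] at hμ₁
    have hab := (abs_lt.1 (show |a - b| < μ / 2 by linarith))
    have h1 : c₁ < 1 := by rw [hc₁, div_lt_iff₀ ha2]; linarith
    have h1' : -1 < c₁ := by rw [hc₁, lt_div_iff₀ ha2]; linarith
    have h2 : c₂ < -1 := by rw [hc₂, div_lt_iff₀ ha2]; linarith
    have h := lintegral_anisoDOS_eq_of_roots (b := b) (μ := μ) ha (a₁ := 1) (a₂ := c₁) (a₃ := -1) (a₄ := c₂)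
      h1 h1' h2 (Ioo_subset_Ioo le_rfl h1.le) (fun c => by rw [← hc₁, ← hc₂]; ring)
      (fun c hc hcs => by
        rw [mem_Ioo, not_and_or, not_lt, not_lt] at hcs
        have hge : c₁ ≤ c := by rcases hcs with h | h <;> linarith [hc.1]
        have hpos : 0 < (1 - c) * (c - -1) * (c - c₂) :=
          _root_.mul_pos (_root_.mul_pos (by linarith [hc.2]) (by linarith [hc.1])) (by linarith [hc.1])
        have : (1 - c) * (c₁ - c) * (c - -1) * (c - c₂) = ((1 - c) * (c - -1) * (c - c₂)) * (c₁ - c) := by ring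
        rw [this]
        exact mul_nonpos_of_nonneg_of_nonpos hpos.le (by linarith))
    rw [h]
    congr 1
    unfold modulusSq
    rw [show (c₁ - -1) * (1 - c₂) / ((1 - (-1:ℝ)) * (c₁ - c₂)) = (c₁ + 1) * (1 - c₂) / (2 * (c₁ - c₂)) by ring,
      hmod, show (1 - (-1:ℝ)) * (c₁ - c₂) = 2 * (c₁ - c₂) by ring, hdiff, hval]
  · -- `μ < 0` (`μ = 0` is excluded by `hμ₁`): roots `c₁ > 1 > c₂ > -1`, middle gap `(c₂, 1)`
    have hμneg : μ < 0 := by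
      rcases lt_or_eq_of_le hμ0 with h | h
      · exact h
      · exfalso; rw [h, abs_zero] at hμ₁; linarith [abs_nonneg (a - b)]
    rw [abs_of_neg hμneg] at hμ₁
    have hab := (abs_lt.1 (show |a - b| < -μ / 2 by linarith))
    have h1 : (1:ℝ) < c₁ := by rw [hc₁, lt_div_iff₀ ha2]; linarith
    have h2 : -1 < c₂ := by rw [hc₂, lt_div_iff₀ ha2]; linarith
    have h2' : c₂ < 1 := by rw [hc₂, div_lt_iff₀ ha2]; linarith
    have h := lintegral_anisoDOS_eq_of_roots (b := b) (μ := μ) ha (a₁ := c₁) (a₂ := 1) (a₃ := c₂) (a₄ := -1)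
      h1 h2' h2 (Ioo_subset_Ioo h2.le le_rfl) (fun c => by rw [← hc₁, ← hc₂]; ring)
      (fun c hc hcs => by
        rw [mem_Ioo, not_and_or, not_lt, not_lt] at hcs
        have hle : c ≤ c₂ := by rcases hcs with h | h <;> linarith [hc.2]
        have hpos : 0 < (c₁ - c) * (1 - c) * (c - -1) :=
          _root_.mul_pos (_root_.mul_pos (by linarith [hc.2]) (by linarith [hc.2])) (by linarith [hc.1])
        have : (c₁ - c) * (1 - c) * (c - c₂) * (c - -1) = ((c₁ - c) * (1 - c) * (c - -1)) * (c - c₂) := by ring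
        rw [this]
        exact mul_nonpos_of_nonneg_of_nonpos hpos.le (by linarith))
    rw [h]
    congr 1
    unfold modulusSq
    rw [show (1 - c₂) * (c₁ - -1) / ((c₁ - c₂) * (1 - (-1:ℝ))) = (c₁ + 1) * (1 - c₂) / (2 * (c₁ - c₂)) by ring,
      hmod, show (c₁ - c₂) * (1 - (-1:ℝ)) = 2 * (c₁ - c₂) by ring, hdiff, hval]

/-- **Outside the band (`|μ| > 2(a+b)`, `a > 0`, `b ≥ 0`)** the density of states vanishes:
`∫⁻_{[-π,π)} 2/√(4b²-(μ+2a cos x)²) dx = 0`. [cite: RaghuKivelsonScalapino2010, §II (6)] -/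
theorem lintegral_anisoDOS_out (ha : 0 < a) (hb : 0 ≤ b) (hμ : 2 * (a + b) < |μ|) :
    ∫⁻ x in Ico (-π) π, ENNReal.ofReal (2 / Real.sqrt (4 * b ^ 2 - (μ + 2 * a * Real.cos x) ^ 2)) = 0 := by
  refine setLIntegral_eq_zero measurableSet_Ico fun x _ => ?_
  have hcos := Real.abs_cos_le_one x
  have h1 : 2 * b < |μ + 2 * a * Real.cos x| := by
    have h2 : |2 * a * Real.cos x| ≤ 2 * a := by
      rw [abs_mul, abs_of_pos (by linarith : (0:ℝ) < 2 * a)]; nlinarith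
    have h3 := abs_sub_abs_le_abs_sub μ (-(2 * a * Real.cos x))
    rw [abs_neg, sub_neg_eq_add] at h3
    linarith
  have h4 : 4 * b ^ 2 - (μ + 2 * a * Real.cos x) ^ 2 ≤ 0 := by
    have := sq_abs (μ + 2 * a * Real.cos x)
    nlinarith [abs_nonneg (μ + 2 * a * Real.cos x)]
  simp only [Pi.zero_apply]
  rw [Real.sqrt_eq_zero'.2 h4, div_zero, ENNReal.ofReal_zero]

/-! ### The same statements for the density-of-states measure of the band -/

/-- **Inner regime, measure form**: for `a, b > 0`, `|μ| < 2|a-b|`,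
`fermiCurveMeasure (k ↦ -2(a cos k₀ + b cos k₁)) μ univ = 8 K(16ab/P)/√P`, `P = 4(a+b)²-μ²`.
[cite: RaghuKivelsonScalapino2010, §II (6)] -/
theorem fermiCurveMeasure_anisoBand_univ_inner (ha : 0 < a) (hb : 0 < b) (hμ : |μ| < 2 * |a - b|) :
    fermiCurveMeasure (fun k : Momentum => -2 * (a * Real.cos (k 0) + b * Real.cos (k 1))) μ univ =
      ENNReal.ofReal (8 * ellipticK (16 * a * b / (4 * (a + b) ^ 2 - μ ^ 2)) /
        Real.sqrt (4 * (a + b) ^ 2 - μ ^ 2)) := by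
  rw [fermiCurveMeasure_anisoBand_univ a b μ hb, lintegral_anisoDOS_inner ha hb hμ]

/-- **Outer regime, measure form**: for `a, b > 0`, `2|a-b| < |μ| < 2(a+b)`,
`fermiCurveMeasure (k ↦ -2(a cos k₀ + b cos k₁)) μ univ = 2 K(P/(16ab))/√(ab)`.
[cite: RaghuKivelsonScalapino2010, §II (6)] -/
theorem fermiCurveMeasure_anisoBand_univ_outer (ha : 0 < a) (hb : 0 < b) (hμ₁ : 2 * |a - b| < |μ|)
    (hμ₂ : |μ| < 2 * (a + b)) :
    fermiCurveMeasure (fun k : Momentum => -2 * (a * Real.cos (k 0) + b * Real.cos (k 1))) μ univ =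
      ENNReal.ofReal (2 * ellipticK ((4 * (a + b) ^ 2 - μ ^ 2) / (16 * a * b)) / Real.sqrt (a * b)) := by
  rw [fermiCurveMeasure_anisoBand_univ a b μ hb, lintegral_anisoDOS_outer ha hb hμ₁ hμ₂]

/-- **Outside the band, measure form**: for `a, b > 0`, `|μ| > 2(a+b)`, the level set is empty-ish and
`fermiCurveMeasure (k ↦ -2(a cos k₀ + b cos k₁)) μ univ = 0`. [cite: RaghuKivelsonScalapino2010, §II (6)] -/
theorem fermiCurveMeasure_anisoBand_univ_out (ha : 0 < a) (hb : 0 < b) (hμ : 2 * (a + b) < |μ|) :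
    fermiCurveMeasure (fun k : Momentum => -2 * (a * Real.cos (k 0) + b * Real.cos (k 1))) μ univ = 0 := by
  rw [fermiCurveMeasure_anisoBand_univ a b μ hb, lintegral_anisoDOS_out ha hb.le hμ]

end Literature.MathematicalPhysics.QuantumLattice
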